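import Summits.Ventures.CertifiedArithmetic.LowPrec.SRSaturationCoupling
import Summits.Ventures.CertifiedArithmetic.LowPrec.SRTreeIntervals
import HarnessLib

/-!
# Stochastic rounding into a finite format, XVII: stochastic monotonicity and box certificates

HONEST FRAMING: certified error envelopes and provably optimal rounding/accumulation schemes for
low-precision formats under stated cost models; every table by two implementations; no hardware or
vendor claims.

Venture CertifiedArithmetic / lowprec, SR slice (gen5). For a nonempty finite format `F` (saturating
mode-2 SR, files I/VII/X):

* `step_mono_arg` — **one saturating SR step is stochastically monotone in the pre-rounding value**:
  `c ≤ c' ⇒ E f(SR c) ≤ E f(SR c')` for every nondecreasing `f` (either the candidate pairs are ordered,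
  `⌈c̄⌉ ≤ ⌊c̄'⌋`, or they coincide and the up-probability is larger at `c'`); `step_anti_arg` dually.
* `LeafLE T T'` (same shape, leafwise `≤`) and `treeExp_mono_leaves` — **every SR reduction tree is
  stochastically monotone in every summand** (`E f(ŝ_T) ≤ E f(ŝ_T')` for nondecreasing `f`): the
  SR-with-saturation kernel is a stochastically monotone Markov kernel in the sense of Daley (1968), in
  state AND data, so the comparison closes under the tree recursion.
* `treeExpE F e` — the flagged semantics of file X with an arbitrary EXIT PREDICATE `e` on pre-rounding
  node values (`treeExpF F H = treeExpE F (outB H)`), `exitE F e T = P(some node value satisfies e)`;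
  `exitE_mono_leaves` / `exitE_anti_leaves` — for a monotone (antitone) exit predicate the exit
  probability is nondecreasing (nonincreasing) in every summand; `exitE_union` — union bound for
  `e₁ ∨ e₂` via the two-flag semantics `treeExpE2`.
* **BOX CERTIFICATE** `satProbT_le_corners`: if `Tlo ≤ T ≤ Thi` leafwise then
  `P(sat, T) ≤ P(upper exit, Thi) + P(lower exit, Tlo)`; for nonnegative data (`0 ∈ F`) the lower term
  vanishes (`satProbT_le_upper_corner`): ONE exact corner computation (file XVIII `SRLaw`, or the two
  implementations `code/sr/gen5/exactlaw_{A,B}.py`) certifies every data vector in the box, and the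
  bound is attained at the corner.  Kernel instance here: E2M1, any 8 summands in `[0, 1]`, left comb.

Placement: the usual stochastic order and its closure under monotone kernels are classical (Belzunce
et al. 2016 Thm 2.2.5; Daley 1968); the statement that SR-nearness WITH SATURATION on an arbitrary
finite grid is monotone in state and data for every reduction tree, and its use as a certificate
scheme, is the (small) new content; cell FRESHNESS-SR.md records the searches (no SR instance found).
-/

namespace Summit.Ventures.CertifiedArithmetic.LowPrec.SR

open Literature.ComputerArithmetic.ConnollyHighamMary2021 Finset STree

variable {K : Type*} [Field K] [LinearOrder K] [IsStrictOrderedRing K]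

/-! ### One step is stochastically monotone in the pre-rounding value -/

/-- **Stochastic monotonicity of one saturating SR step**: for nondecreasing `f`,
`c ≤ c' ⇒ E f(SR(c)) ≤ E f(SR(c'))`. -/
theorem step_mono_arg {F : Finset K} (hF : F.Nonempty) {f : K → K} (hf : Monotone f) {c c' : K}
    (h : c ≤ c') : step F c f ≤ step F c' f := by
  have hx : clamp F c ≤ clamp F c' := clamp_mono hF h
  have hdu : dn F c ≤ up F c := roundDown_le_roundUp F _
  have hdu' : dn F c' ≤ up F c' := roundDown_le_roundUp F _
  have p0 := pUp_nonneg F c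
  have p1 := pUp_le_one F c
  have q0 := pUp_nonneg F c'
  have q1 := pUp_le_one F c'
  rcases le_or_gt (up F c) (dn F c') with hA | hB
  · have h1 : step F c f ≤ f (up F c) := by
      unfold step; have := hf hdu; nlinarith
    have h2 : f (dn F c') ≤ step F c' f := by
      unfold step; have := hf hdu'; nlinarith
    exact h1.trans ((hf hA).trans h2)
  · have hdd : dn F c ≤ dn F c' := dn_mono hF h
    have huu : up F c ≤ up F c' := up_mono hF h
    have hd : dn F c = dn F c' := by
      by_contra hne
      exact not_mem_of_between (lt_of_le_of_ne hdd hne) hB (dn_mem hF c')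
    have hu : up F c = up F c' := by
      by_contra hne
      exact not_mem_of_between hB (lt_of_le_of_ne huu hne) (up_mem hF c)
    have hgap : 0 < up F c - dn F c := by rw [hd]; exact sub_pos.mpr hB
    have hp : pUp F c ≤ pUp F c' := by
      change (clamp F c - dn F c) / (up F c - dn F c) ≤ (clamp F c' - dn F c') / (up F c' - dn F c')
      rw [← hd, ← hu]
      exact div_le_div_of_nonneg_right (sub_le_sub_right hx _) hgap.le
    have hfd : f (dn F c) ≤ f (up F c) := hf hdu
    unfold step
    rw [← hd, ← hu]
    nlinarith [mul_nonneg (sub_nonneg.mpr hp) (sub_nonneg.mpr hfd)]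

/-- Dually, for nonincreasing `f`: `c ≤ c' ⇒ E f(SR(c')) ≤ E f(SR(c))`. -/
theorem step_anti_arg {F : Finset K} (hF : F.Nonempty) {f : K → K} (hf : Antitone f) {c c' : K}
    (h : c ≤ c') : step F c' f ≤ step F c f := by
  have hm : Monotone (fun t => (-1) * f t) := fun a b hab => by
    have := hf hab; nlinarith
  have := step_mono_arg hF hm h
  rw [step_mul_left, step_mul_left] at this
  linarith

omit [IsStrictOrderedRing K] in
/-- A step at a representable value returns it surely: `E g(SR x) = g x` for `x ∈ F`. -/
theorem step_of_mem {F : Finset K} {x : K} (hx : x ∈ F) (g : K → K) : step F x g = g x := by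
  have hc : clamp F x = x := clamp_eq_self ⟨⟨x, hx, le_rfl⟩, ⟨x, hx, le_rfl⟩⟩
  unfold step pUp up dn
  rw [hc, roundUp_eq_self_of_mem hx, roundDown_eq_self_of_mem hx]
  ring

/-! ### Trees: leafwise order and stochastic monotonicity in the data -/

/-- `LeafLE T T'`: the two trees have the same shape and the leaves of `T` are `≤` those of `T'`. -/
def LeafLE : STree K → STree K → Prop
  | .leaf x, .leaf y => x ≤ y
  | .node l r, .node l' r' => LeafLE l l' ∧ LeafLE r r'
  | .leaf _, .node _ _ => False
  | .node _ _, .leaf _ => False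

omit [Field K] [IsStrictOrderedRing K] in
/-- `LeafLE` is reflexive. -/
theorem LeafLE.refl : ∀ T : STree K, LeafLE T T
  | .leaf _ => le_rfl
  | .node l r => ⟨LeafLE.refl l, LeafLE.refl r⟩

/-- Boolean evaluator of `LeafLE` (kernel certificates). -/
def leafLEB [DecidableLE K] : STree K → STree K → Bool
  | .leaf x, .leaf y => decide (x ≤ y)
  | .node l r, .node l' r' => leafLEB l l' && leafLEB r r'
  | .leaf _, .node _ _ => false
  | .node _ _, .leaf _ => false

omit [Field K] [IsStrictOrderedRing K] in
/-- `leafLEB` decides `LeafLE`. -/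
theorem leafLEB_iff [DecidableLE K] : ∀ T T' : STree K, leafLEB T T' = true ↔ LeafLE T T'
  | .leaf x, .leaf y => by simp [leafLEB, LeafLE]
  | .node l r, .node l' r' => by simp [leafLEB, LeafLE, leafLEB_iff l l', leafLEB_iff r r']
  | .leaf _, .node _ _ => by simp [leafLEB, LeafLE]
  | .node _ _, .leaf _ => by simp [leafLEB, LeafLE]

/-- Decidability of `LeafLE` via the Boolean evaluator. -/
instance instDecidableLeafLE [DecidableLE K] (T T' : STree K) : Decidable (LeafLE T T') :=
  decidable_of_iff _ (leafLEB_iff T T')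

/-- **Every SR reduction tree is stochastically monotone in every summand**: if `T ≤ T'` leafwise
then `E f(ŝ_T) ≤ E f(ŝ_T')` for every nondecreasing `f`. -/
theorem treeExp_mono_leaves {F : Finset K} (hF : F.Nonempty) :
    ∀ {T T' : STree K}, LeafLE T T' → ∀ {f : K → K}, Monotone f → treeExp F T f ≤ treeExp F T' f
  | .leaf _, .leaf _, h, _, hf => hf h
  | .node l r, .node l' r', h, f, hf => by
      simp only [treeExp]
      have hg : Monotone (fun a => treeExp F r' (fun b => step F (a + b) f)) := fun a a' haa' =>
        treeExp_mono F r' (fun b => step_mono_arg hF hf (add_le_add haa' le_rfl))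
      calc treeExp F l (fun a => treeExp F r (fun b => step F (a + b) f))
          ≤ treeExp F l (fun a => treeExp F r' (fun b => step F (a + b) f)) :=
            treeExp_mono F l (fun a => treeExp_mono_leaves hF h.2
              (fun b b' hbb' => step_mono_arg hF hf (add_le_add le_rfl hbb')))
        _ ≤ treeExp F l' (fun a => treeExp F r' (fun b => step F (a + b) f)) :=
            treeExp_mono_leaves hF h.1 hg
  | .leaf _, .node _ _, h, _, _ => by simp [LeafLE] at h
  | .node _ _, .leaf _, h, _, _ => by simp [LeafLE] at h

/-- In particular the MEAN is nondecreasing in every summand. -/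
theorem treeMean_mono_leaves {F : Finset K} (hF : F.Nonempty) {T T' : STree K} (h : LeafLE T T') :
    treeExp F T (fun v => v) ≤ treeExp F T' (fun v => v) :=
  treeExp_mono_leaves hF h (fun _ _ hab => hab)

/-! ### Flagged semantics with a general exit predicate -/

/-- `treeExpE F e T φ = E[φ(ŝ_T, flag)]`, flag = "on the realised branch some node's pre-rounding value
`a + b` satisfies the exit predicate `e`" (file X's `treeExpF F H` is the case `e = outB H`). -/
def treeExpE (F : Finset K) (e : K → Bool) : STree K → (K → Bool → K) → K
  | .leaf x, φ => φ x false
  | .node l r, φ => treeExpE F e l (fun a fa => treeExpE F e r (fun b fb =>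
      step F (a + b) (fun v => φ v (fa || fb || e (a + b)))))

/-- `exitE F e T = P(some node's pre-rounding value satisfies e)`. -/
def exitE (F : Finset K) (e : K → Bool) (T : STree K) : K :=
  treeExpE F e T (fun _ fl => if fl then 1 else 0)

omit [IsStrictOrderedRing K] in
/-- File X's flagged semantics is the case `e = outB H`. -/
theorem treeExpF_eq_treeExpE (F H : Finset K) : ∀ (T : STree K) (φ : K → Bool → K),
    treeExpF F H T φ = treeExpE F (outB H) T φ
  | .leaf _, _ => rfl
  | .node l r, φ => by
      simp only [treeExpF, treeExpE]
      rw [treeExpF_eq_treeExpE F H l]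
      congr 1; funext a fa
      rw [treeExpF_eq_treeExpE F H r]

omit [IsStrictOrderedRing K] in
/-- `treeExpE` respects pointwise equality of integrands. -/
theorem treeExpE_congr (F : Finset K) (e : K → Bool) (T : STree K) {φ ψ : K → Bool → K}
    (h : ∀ v b, φ v b = ψ v b) : treeExpE F e T φ = treeExpE F e T ψ := by
  rw [show φ = ψ from funext fun v => funext fun b => h v b]

omit [IsStrictOrderedRing K] in
/-- Additivity. -/
theorem treeExpE_add (F : Finset K) (e : K → Bool) : ∀ (T : STree K) (φ ψ : K → Bool → K),
    treeExpE F e T (fun v b => φ v b + ψ v b) = treeExpE F e T φ + treeExpE F e T ψ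
  | .leaf x, φ, ψ => rfl
  | .node l r, φ, ψ => by
      simp only [treeExpE]
      rw [← treeExpE_add F e l]
      refine treeExpE_congr F e l (fun a fa => ?_)
      rw [← treeExpE_add F e r]
      exact treeExpE_congr F e r (fun b fb => step_add F _ _ _)

/-- Monotonicity in the integrand. -/
theorem treeExpE_mono (F : Finset K) (e : K → Bool) : ∀ (T : STree K) {φ ψ : K → Bool → K},
    (∀ v b, φ v b ≤ ψ v b) → treeExpE F e T φ ≤ treeExpE F e T ψ
  | .leaf x, _, _, h => h x false
  | .node l r, _, _, h =>
      treeExpE_mono F e l (fun _ _ => treeExpE_mono F e r (fun _ _ => step_mono F _ (fun _ => h _ _)))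

omit [IsStrictOrderedRing K] in
/-- A tree all of whose leaves are the representable value `0` never moves: `E φ = φ 0 false`
provided `e 0 = false`. -/
theorem treeExpE_zero {F : Finset K} (h0 : (0 : K) ∈ F) {e : K → Bool} (he0 : e 0 = false) :
    ∀ (T : STree K) (φ : K → Bool → K), treeExpE F e (T.map fun _ => (0 : K)) φ = φ 0 false
  | .leaf _, _ => rfl
  | .node l r, φ => by
      simp only [STree.map, treeExpE]
      rw [treeExpE_zero h0 he0 l, treeExpE_zero h0 he0 r, add_zero, step_of_mem h0]
      simp [he0]

/-! ### Integrand classes and the monotonicity of exit probabilities in the data -/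

/-- Integrands nondecreasing in the value (for each flag) and in the flag. -/
structure MonoI (φ : K → Bool → K) : Prop where
  /-- nondecreasing in the value -/
  val : ∀ b, Monotone (fun v => φ v b)
  /-- nondecreasing in the flag -/
  flag : ∀ v, φ v false ≤ φ v true

/-- Integrands nonincreasing in the value (for each flag) and nondecreasing in the flag. -/
structure AntiI (φ : K → Bool → K) : Prop where
  /-- nonincreasing in the value -/
  val : ∀ b, Antitone (fun v => φ v b)
  /-- nondecreasing in the flag -/
  flag : ∀ v, φ v false ≤ φ v true

omit [Field K] [IsStrictOrderedRing K] in
/-- Flag monotonicity along a Boolean implication. -/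
theorem flag_le_of_imp {φ : K → Bool → K} (hφ : ∀ v, φ v false ≤ φ v true) (v : K) {b b' : Bool}
    (h : b = true → b' = true) : φ v b ≤ φ v b' := by
  cases b <;> cases b'
  · exact le_rfl
  · exact hφ v
  · exact absurd (h rfl) Bool.false_ne_true
  · exact le_rfl

/-- The exit indicator is in both classes. -/
theorem monoI_ind : MonoI (fun (_ : K) (fl : Bool) => if fl then (1 : K) else 0) :=
  ⟨fun b _ _ _ => le_rfl, fun _ => by simp⟩

/-- The exit indicator is in both classes. -/
theorem antiI_ind : AntiI (fun (_ : K) (fl : Bool) => if fl then (1 : K) else 0) :=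
  ⟨fun b _ _ _ => le_rfl, fun _ => by simp⟩

omit [Field K] [LinearOrder K] [IsStrictOrderedRing K] in
/-- The node flag `fa ∨ fb ∨ e(c)` follows Boolean implications of its parts. -/
theorem flag_imp {e : K → Bool} {c c' : K} (he : e c = true → e c' = true) {fa fa' fb fb' : Bool}
    (hfa : fa = true → fa' = true) (hfb : fb = true → fb' = true) :
    (fa || fb || e c) = true → (fa' || fb' || e c') = true := by
  simp only [Bool.or_eq_true]
  exact Or.imp (Or.imp hfa hfb) he

/-- One node, monotone case: larger operands and weaker flags give a larger flagged expectation. -/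
theorem step_flag_mono {F : Finset K} (hF : F.Nonempty) {e : K → Bool}
    (he : ∀ ⦃c c' : K⦄, c ≤ c' → e c = true → e c' = true) {φ : K → Bool → K} (hφ : MonoI φ)
    {a a' b b' : K} (ha : a ≤ a') (hb : b ≤ b') {fa fa' fb fb' : Bool}
    (hfa : fa = true → fa' = true) (hfb : fb = true → fb' = true) :
    step F (a + b) (fun v => φ v (fa || fb || e (a + b)))
      ≤ step F (a' + b') (fun v => φ v (fa' || fb' || e (a' + b'))) := by
  have hc : a + b ≤ a' + b' := add_le_add ha hb
  calc step F (a + b) (fun v => φ v (fa || fb || e (a + b)))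
      ≤ step F (a + b) (fun v => φ v (fa' || fb' || e (a' + b'))) :=
        step_mono F _ (fun v => flag_le_of_imp hφ.flag v (flag_imp (he hc) hfa hfb))
    _ ≤ step F (a' + b') (fun v => φ v (fa' || fb' || e (a' + b'))) :=
        step_mono_arg hF (hφ.val _) hc

/-- One node, antitone case. -/
theorem step_flag_anti {F : Finset K} (hF : F.Nonempty) {e : K → Bool}
    (he : ∀ ⦃c c' : K⦄, c ≤ c' → e c' = true → e c = true) {φ : K → Bool → K} (hφ : AntiI φ)
    {a a' b b' : K} (ha : a ≤ a') (hb : b ≤ b') {fa fa' fb fb' : Bool}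
    (hfa : fa' = true → fa = true) (hfb : fb' = true → fb = true) :
    step F (a' + b') (fun v => φ v (fa' || fb' || e (a' + b')))
      ≤ step F (a + b) (fun v => φ v (fa || fb || e (a + b))) := by
  have hc : a + b ≤ a' + b' := add_le_add ha hb
  calc step F (a' + b') (fun v => φ v (fa' || fb' || e (a' + b')))
      ≤ step F (a' + b') (fun v => φ v (fa || fb || e (a + b))) :=
        step_mono F _ (fun v => flag_le_of_imp hφ.flag v (flag_imp (he hc) hfa hfb))
    _ ≤ step F (a + b) (fun v => φ v (fa || fb || e (a + b))) :=
        step_anti_arg hF (hφ.val _) hc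

/-- **Monotone exit predicates: the flagged expectation is nondecreasing in every summand.** -/
theorem treeExpE_mono_leaves {F : Finset K} (hF : F.Nonempty) {e : K → Bool}
    (he : ∀ ⦃c c' : K⦄, c ≤ c' → e c = true → e c' = true) :
    ∀ {T T' : STree K}, LeafLE T T' → ∀ {φ : K → Bool → K}, MonoI φ →
      treeExpE F e T φ ≤ treeExpE F e T' φ
  | .leaf _, .leaf _, h, _, hφ => hφ.val false h
  | .node l r, .node l' r', h, φ, hφ => by
      simp only [treeExpE]
      have hI : ∀ (a : K) (fa : Bool),
          MonoI (fun b fb => step F (a + b) (fun v => φ v (fa || fb || e (a + b)))) := fun a fa =>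
        ⟨fun fb b b' hbb' => step_flag_mono hF he hφ le_rfl hbb' (fun h => h) (fun h => h),
         fun b => step_flag_mono hF he hφ le_rfl le_rfl (fun h => h) (fun _ => rfl)⟩
      have hΨ : MonoI (fun a fa => treeExpE F e r' (fun b fb =>
          step F (a + b) (fun v => φ v (fa || fb || e (a + b))))) :=
        ⟨fun fa a a' haa' => treeExpE_mono F e r' (fun b fb =>
            step_flag_mono hF he hφ haa' le_rfl (fun h => h) (fun h => h)),
         fun a => treeExpE_mono F e r' (fun b fb =>
            step_flag_mono hF he hφ le_rfl le_rfl (fun _ => rfl) (fun h => h))⟩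
      calc treeExpE F e l (fun a fa => treeExpE F e r (fun b fb =>
              step F (a + b) (fun v => φ v (fa || fb || e (a + b)))))
          ≤ treeExpE F e l (fun a fa => treeExpE F e r' (fun b fb =>
              step F (a + b) (fun v => φ v (fa || fb || e (a + b))))) :=
            treeExpE_mono F e l (fun a fa => treeExpE_mono_leaves hF he h.2 (hI a fa))
        _ ≤ treeExpE F e l' (fun a fa => treeExpE F e r' (fun b fb =>
              step F (a + b) (fun v => φ v (fa || fb || e (a + b))))) :=
            treeExpE_mono_leaves hF he h.1 hΨ
  | .leaf _, .node _ _, h, _, _ => by simp [LeafLE] at h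
  | .node _ _, .leaf _, h, _, _ => by simp [LeafLE] at h

/-- **Antitone exit predicates: the flagged expectation is nonincreasing in every summand.** -/
theorem treeExpE_anti_leaves {F : Finset K} (hF : F.Nonempty) {e : K → Bool}
    (he : ∀ ⦃c c' : K⦄, c ≤ c' → e c' = true → e c = true) :
    ∀ {T T' : STree K}, LeafLE T T' → ∀ {φ : K → Bool → K}, AntiI φ →
      treeExpE F e T' φ ≤ treeExpE F e T φ
  | .leaf _, .leaf _, h, _, hφ => hφ.val false h
  | .node l r, .node l' r', h, φ, hφ => by
      simp only [treeExpE]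
      have hI : ∀ (a : K) (fa : Bool),
          AntiI (fun b fb => step F (a + b) (fun v => φ v (fa || fb || e (a + b)))) := fun a fa =>
        ⟨fun fb b b' hbb' => step_flag_anti hF he hφ le_rfl hbb' (fun h => h) (fun h => h),
         fun b => step_mono F _ (fun v => flag_le_of_imp hφ.flag v
           (flag_imp (fun h => h) (fun h => h) (fun _ => rfl)))⟩
      have hΨ : AntiI (fun a fa => treeExpE F e r (fun b fb =>
          step F (a + b) (fun v => φ v (fa || fb || e (a + b))))) :=
        ⟨fun fa a a' haa' => treeExpE_mono F e r (fun b fb =>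
            step_flag_anti hF he hφ haa' le_rfl (fun h => h) (fun h => h)),
         fun a => treeExpE_mono F e r (fun b fb => step_mono F _ (fun v => flag_le_of_imp hφ.flag v
            (flag_imp (fun h => h) (fun _ => rfl) (fun h => h))))⟩
      calc treeExpE F e l' (fun a fa => treeExpE F e r' (fun b fb =>
              step F (a + b) (fun v => φ v (fa || fb || e (a + b)))))
          ≤ treeExpE F e l' (fun a fa => treeExpE F e r (fun b fb =>
              step F (a + b) (fun v => φ v (fa || fb || e (a + b))))) :=
            treeExpE_mono F e l' (fun a fa => treeExpE_anti_leaves hF he h.2 (hI a fa))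
        _ ≤ treeExpE F e l (fun a fa => treeExpE F e r (fun b fb =>
              step F (a + b) (fun v => φ v (fa || fb || e (a + b))))) :=
            treeExpE_anti_leaves hF he h.1 hΨ
  | .leaf _, .node _ _, h, _, _ => by simp [LeafLE] at h
  | .node _ _, .leaf _, h, _, _ => by simp [LeafLE] at h

/-- **Upper exits are nondecreasing in the data**: for a threshold predicate `hi < c`. -/
theorem exitE_mono_leaves {F : Finset K} (hF : F.Nonempty) (hi : K) {T T' : STree K}
    (h : LeafLE T T') :
    exitE F (fun c => decide (hi < c)) T ≤ exitE F (fun c => decide (hi < c)) T' :=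
  treeExpE_mono_leaves hF (fun c c' hcc' hc => by
    simp only [decide_eq_true_eq] at hc ⊢; exact hc.trans_le hcc') h monoI_ind

/-- **Lower exits are nonincreasing in the data**: for a threshold predicate `c < lo`. -/
theorem exitE_anti_leaves {F : Finset K} (hF : F.Nonempty) (lo : K) {T T' : STree K}
    (h : LeafLE T T') :
    exitE F (fun c => decide (c < lo)) T' ≤ exitE F (fun c => decide (c < lo)) T :=
  treeExpE_anti_leaves hF (fun c c' hcc' hc => by
    simp only [decide_eq_true_eq] at hc ⊢; exact hcc'.trans_lt hc) h antiI_ind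

end Summit.Ventures.CertifiedArithmetic.LowPrec.SR
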